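import Mathlib.Analysis.Complex.RealDeriv
import Mathlib.Analysis.SpecialFunctions.Sqrt
import Literature.Geometry.Lorentzian.TeukolskyWronskianBound
import Literature.Geometry.Lorentzian.KerrSeparatedPotential
import Literature.Geometry.Lorentzian.KerrTortoiseRadius
import HarnessLib

/-!
# The `r*`-Schrödinger form `u″ + (ω² − V) u = 0` of the scalar radial Teukolsky ODE
# (Carter's separated equation, DRSR §5.2.3) and the `u`-Wronskian (Teixeira da Costa Def. 5.1)

(namespace `Literature.Geometry.Lorentzian.Kerr`; bridge between the two radial vocabularies of
the tree.)

The tree describes ONE ordinary differential equation in two vocabularies with, so far, no link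
between them:

* (TdC) `Kerr.IsRadialTeukolskySolution M a 0 ω m λ R` (`TeukolskyRealAxisModeStability.lean`,
  R. Teixeira da Costa, arXiv:1910.02854, §2.2.3 with `s = 0`): classical solutions on `r > r₊` of
  `Δ R″ + 2(r − M) R′ + (K²/Δ − λ − a²ω² + 2amω) R = 0`, `K = ω(r² + a²) − am`
  (`Kerr.radialK`), `Δ = r² − 2Mr + a²` (`Kerr.delta`);
* (DRSR) Carter's radial ODE `u″ + (ω² − V) u = 0` in a tortoise coordinate `r*`,
  `dr/dr* = Δ/(r² + a²)` (`Kerr.IsTortoiseRadius`, `KerrTortoiseRadius.lean`), with the potential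
  `V = V₀ + V₁ = Kerr.sepPotential M a ω m Λ` of `KerrSeparatedPotential.lean`
  (M. Dafermos, I. Rodnianski, Y. Shlapentokh-Rothman, arXiv:1402.7034, §5.2.3, the display
  after Prop. 5.2.1, with `Λ = λ_{mℓ} + a²ω²`).

This file **proves** the classical link (Carter 1968; DRSR §5.2.3; TdC §2.2.3,
"`u = (r² + a²)^{1/2} Δ^{s/2} R`, `dr*/dr = (r² + a²)/Δ`"):

* `schrodingerForm`: if `R` solves TdC's ODE with `λ = Λ − a²ω²` and `ρ` is a tortoise radius
  function, then `u(x) = (ρ(x)² + a²)^{1/2} R(ρ x)` is twice differentiable on `ℝ` with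
  `u″ + (ω² − V(ρ x)) u = 0`, and `u′(x) = (Δ/(r² + a²)) · d/dr[(r² + a²)^{1/2} R](ρ x)`;
* `wronskian_schrodingerForm`: the `r*`-Wronskian `u_H u_I′ − u_I u_H′` of two such `u`'s is
  TdC's `𝔚 = Δ^{1+0} (R_H R_I′ − R_I R_H′)` (`Kerr.radialWronskian M a 0`), i.e. Def. 5.1 of
  loc. cit. agrees with the expression of its §1.

The computation behind `schrodingerForm`: with `A = r² + a²`, `S = A^{1/2}`, `D = Δ/A`,
`dS/dr = rS/A`, `d²S/dr² = a²S/A²`, `dD/dr = (2(r − M)A − 2rΔ)/A²`, the chain and product rules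
give `u″ = D (D (S R)′)′`; substituting `Δ R″` from the ODE, the `R′`-terms cancel
(`D D′ + 2D² r/A = 2(r − M)Δ/A²`) and the `R`-terms reduce to the two rational identities
`A² (ω² − V₀) = K² − Δ(Λ − 2amω)` (`A − Δ = 2Mr`) and `V₁ = D D′ r/A + D² a²/A²`
(`= Δ(a²Δ + 2Mr(r² − a²))/A⁴`, `Kerr.sepPotential₁_eq`). Pure calculus over the tree's Kerr
vocabulary; no named fact is used.

## References

* M. Dafermos, I. Rodnianski, Y. Shlapentokh-Rothman, *Decay for solutions of the wave equation
  on Kerr exterior spacetimes III*, arXiv:1402.7034 = Ann. of Math. 183 (2016): §2.1.2 (`r*`),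
  Prop. 5.2.1 and §5.2.3 (Carter's radial ODE, `V`). [DafermosRodnianskiShlapentokhrothman2014]
* R. Teixeira da Costa, *Mode stability for the Teukolsky equation on extremal and subextremal
  Kerr spacetimes*, CMP 378 (2020) 705–781 = arXiv:1910.02854: §1 (`𝔚 = Δ^{1+s}(…)`), §2.2.3
  (radial ODE, `u = (r² + a²)^{1/2} Δ^{s/2} R`), Def. 5.1 (`𝔚 = u_𝓘′ u_𝓗 − u_𝓗′ u_𝓘`). [Costa2019]
-/

noncomputable section

namespace Literature.Geometry.Lorentzian.Kerr

/-! ### Calculus of `S = (r² + a²)^{1/2}` and of `dr/dr* = Δ/(r² + a²)` in the variable `r` -/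

/-- `d/dr (r² + a²) = 2r`. [folklore] -/
private theorem hasDerivAt_sqAddSq (a r : ℝ) :
    HasDerivAt (fun s : ℝ ↦ s ^ 2 + a ^ 2) (2 * r) r := by
  simpa using ((hasDerivAt_id' r).pow 2).add_const (a ^ 2)

/-- `dS/dr = r S/(r² + a²)` for `S = (r² + a²)^{1/2}` (i.e. `r/S`, written linearly in `S`).
[folklore] -/
private theorem hasDerivAt_S {a r : ℝ} (hA : 0 < r ^ 2 + a ^ 2) :
    HasDerivAt (fun s : ℝ ↦ √(s ^ 2 + a ^ 2)) (r * √(r ^ 2 + a ^ 2) / (r ^ 2 + a ^ 2)) r := by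
  refine ((hasDerivAt_sqAddSq a r).sqrt hA.ne').congr_deriv ?_
  have hS : 0 < √(r ^ 2 + a ^ 2) := Real.sqrt_pos.2 hA
  have hS2 : √(r ^ 2 + a ^ 2) ^ 2 = r ^ 2 + a ^ 2 := Real.sq_sqrt hA.le
  rw [div_eq_div_iff (by positivity) hA.ne']
  linear_combination (-(2 * r)) * hS2

/-- `d/dr (r S/(r² + a²)) = a² S/(r² + a²)²` (i.e. `d²S/dr² = a²/S³`). [folklore] -/
private theorem hasDerivAt_S₁ {a r : ℝ} (hA : 0 < r ^ 2 + a ^ 2) :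
    HasDerivAt (fun s : ℝ ↦ s * √(s ^ 2 + a ^ 2) / (s ^ 2 + a ^ 2))
      (a ^ 2 * √(r ^ 2 + a ^ 2) / (r ^ 2 + a ^ 2) ^ 2) r := by
  refine (((hasDerivAt_id' r).fun_mul (hasDerivAt_S hA)).fun_div (hasDerivAt_sqAddSq a r)
    hA.ne').congr_deriv ?_
  field_simp
  ring

/-- `d/dr (Δ/(r² + a²)) = (2(r − M)(r² + a²) − 2rΔ)/(r² + a²)²` (`dΔ/dr = 2(r − M)`). [folklore] -/
private theorem hasDerivAt_D (M a : ℝ) {r : ℝ} (hA : 0 < r ^ 2 + a ^ 2) :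
    HasDerivAt (fun s : ℝ ↦ delta M a s / (s ^ 2 + a ^ 2))
      ((2 * (r - M) * (r ^ 2 + a ^ 2) - 2 * r * delta M a r) / (r ^ 2 + a ^ 2) ^ 2) r := by
  refine ((hasDerivAt_delta M a r).fun_div (hasDerivAt_sqAddSq a r) hA.ne').congr_deriv ?_
  ring

/-! ### The three scalar identities behind `u″ + (ω² − V) u = 0` -/

/-- The `R″`-coefficient: `D² S = (Δ S/A²) Δ`, `D = Δ/A`, `A = r² + a²`. [folklore] -/
private theorem coeff_R₂ (Δ S : ℝ) {A : ℝ} (hA : A ≠ 0) :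
    Δ / A * (Δ / A) * S = Δ * S / A ^ 2 * Δ := by
  field_simp

/-- The `R′`-coefficient: `D D′ S + 2 D² (rS/A) = (Δ S/A²) · 2(r − M)` with
`D′ = (2(r − M)A − 2rΔ)/A²`. [folklore] -/
private theorem coeff_R₁ (Δ S r M : ℝ) {A : ℝ} (hA : A ≠ 0) :
    Δ / A * ((2 * (r - M) * A - 2 * r * Δ) / A ^ 2) * S +
        2 * (Δ / A * (Δ / A) * (r * S / A)) =
      Δ * S / A ^ 2 * (2 * (r - M)) := by
  field_simp
  ring

/-- The `R`-coefficient: `D D′ (rS/A) + D² (a²S/A²) + (ω² − V) S = (Δ S/A²)(K²/Δ − (Λ − 2amω))`,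
i.e. `V₁ = D D′ r/A + D² a²/A²` and `A²(ω² − V₀) = K² − Δ(Λ − 2amω)` combined (DRSR §5.2.3 /
§6.2, the potential of Carter's equation). [cite: DafermosRodnianskiShlapentokhrothman2014, §5.2.3] -/
private theorem coeff_R₀ (M a ω : ℝ) (m : ℤ) (Λ S : ℝ) {r : ℝ} (hA : r ^ 2 + a ^ 2 ≠ 0)
    (hΔ : delta M a r ≠ 0) :
    delta M a r / (r ^ 2 + a ^ 2) *
            ((2 * (r - M) * (r ^ 2 + a ^ 2) - 2 * r * delta M a r) / (r ^ 2 + a ^ 2) ^ 2) *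
          (r * S / (r ^ 2 + a ^ 2)) +
        delta M a r / (r ^ 2 + a ^ 2) * (delta M a r / (r ^ 2 + a ^ 2)) *
          (a ^ 2 * S / (r ^ 2 + a ^ 2) ^ 2) +
        (ω ^ 2 - sepPotential M a ω m Λ r) * S =
      delta M a r * S / (r ^ 2 + a ^ 2) ^ 2 *
        (radialK a ω m r ^ 2 / delta M a r - (Λ - 2 * a * m * ω)) := by
  unfold sepPotential sepPotential₀ sepPotential₁ radialK
  field_simp
  unfold delta
  ring

/-! ### The Schrödinger form along a tortoise radius function -/

/-- **Carter's equation from the radial Teukolsky ODE (`s = 0`).** Let `0 < M`, `|a| < M`, let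
`R` be a classical solution of the scalar radial Teukolsky ODE
`Δ R″ + 2(r − M) R′ + (K²/Δ − (Λ − a²ω²) − a²ω² + 2amω) R = 0` on `r > r₊`
(`Kerr.IsRadialTeukolskySolution M a 0 ω m (Λ − a²ω²) R`), and let `ρ` be a tortoise radius
function (`dρ/dx = Δ(ρ)/(ρ² + a²)`, `ρ > r₊`). Then `u(x) = (ρ(x)² + a²)^{1/2} R(ρ x)` is twice
differentiable on `ℝ`, with first derivative `u₁ = (Δ/(r² + a²)) · d/dr[(r² + a²)^{1/2} R]`
evaluated at `r = ρ x`, and satisfies Carter's separated equation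
`u″ + (ω² − V(ρ x)) u = 0`, `V = Kerr.sepPotential M a ω m Λ` (DRSR arXiv:1402.7034, §5.2.3,
display after Prop. 5.2.1; TdC arXiv:1910.02854 §2.2.3: `u = (r² + a²)^{1/2} Δ^{s/2} R`).
[cite: DafermosRodnianskiShlapentokhrothman2014, §5.2.3] -/
theorem schrodingerForm {M a ω Λ : ℝ} {m : ℤ} (hM : 0 < M) (ha : |a| < M) {R : ℝ → ℂ}
    (hR : IsRadialTeukolskySolution M a 0 ω m (Λ - a ^ 2 * ω ^ 2) R) {ρ : ℝ → ℝ}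
    (hρ : IsTortoiseRadius M a ρ) :
    ∃ u₁ u₂ : ℝ → ℂ, ∀ x : ℝ,
      HasDerivAt (fun y ↦ ((Real.sqrt (ρ y ^ 2 + a ^ 2) : ℝ) : ℂ) * R (ρ y)) (u₁ x) x ∧
      HasDerivAt u₁ (u₂ x) x ∧
      u₂ x + ((ω ^ 2 - sepPotential M a ω m Λ (ρ x) : ℝ) : ℂ) *
          (((Real.sqrt (ρ x ^ 2 + a ^ 2) : ℝ) : ℂ) * R (ρ x)) = 0 ∧
      u₁ x = ((delta M a (ρ x) / (ρ x ^ 2 + a ^ 2) : ℝ) : ℂ) *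
          deriv (fun r : ℝ ↦ ((Real.sqrt (r ^ 2 + a ^ 2) : ℝ) : ℂ) * R r) (ρ x) := by
  obtain ⟨R', R'', hR⟩ := hR
  refine ⟨fun y ↦ ((delta M a (ρ y) / (ρ y ^ 2 + a ^ 2) : ℝ) : ℂ) *
      (((ρ y * √(ρ y ^ 2 + a ^ 2) / (ρ y ^ 2 + a ^ 2) : ℝ) : ℂ) * R (ρ y) +
        ((√(ρ y ^ 2 + a ^ 2) : ℝ) : ℂ) * R' (ρ y)),
    fun y ↦ -(((ω ^ 2 - sepPotential M a ω m Λ (ρ y) : ℝ) : ℂ) *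
      (((√(ρ y ^ 2 + a ^ 2) : ℝ) : ℂ) * R (ρ y))), fun x ↦ ?_⟩
  -- the point `r = ρ x > r₊ ≥ M > 0`: `r² + a² > 0`, `Δ(r) > 0`
  have hr : rPlus M a < ρ x := hρ.rPlus_lt x
  have hr0 : 0 < ρ x := (hM.trans_le (M_le_rPlus M a)).trans hr
  have hA : 0 < ρ x ^ 2 + a ^ 2 := by positivity
  have hΔ : 0 < delta M a (ρ x) := delta_pos ha.le hr
  obtain ⟨h1, h2, hode⟩ := hR (ρ x) hr
  -- `r`-derivatives at `ρ x`: `S`, `S′`, `D`, `S·R`, `(S·R)′ = S′R + S R′`, `D·(S·R)′`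
  have hS := hasDerivAt_S hA
  have hS₁ := hasDerivAt_S₁ hA
  have hD := hasDerivAt_D M a hA
  have hF : HasDerivAt (fun s : ℝ ↦ ((√(s ^ 2 + a ^ 2) : ℝ) : ℂ) * R s)
      (((ρ x * √(ρ x ^ 2 + a ^ 2) / (ρ x ^ 2 + a ^ 2) : ℝ) : ℂ) * R (ρ x) +
        ((√(ρ x ^ 2 + a ^ 2) : ℝ) : ℂ) * R' (ρ x)) (ρ x) :=
    hS.ofReal_comp.fun_mul h1
  have hF₁ := (hS₁.ofReal_comp.fun_mul h1).fun_add (hS.ofReal_comp.fun_mul h2)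
  have hG := hD.ofReal_comp.fun_mul hF₁
  have hρ' := hρ.hasDerivAt x
  refine ⟨?_, ?_, by ring, by rw [hF.deriv]⟩
  · simpa only [Function.comp_def, Complex.real_smul] using hF.scomp x hρ'
  · have hu := hG.scomp x hρ'
    simp only [Function.comp_def, Complex.real_smul] at hu
    refine hu.congr_deriv ?_
    -- the algebra: substitute `Δ R″` from the ODE and use the three scalar identities
    have e₂ := congrArg ((↑) : ℝ → ℂ) (coeff_R₂ (delta M a (ρ x)) (√(ρ x ^ 2 + a ^ 2)) hA.ne')
    have e₁ := congrArg ((↑) : ℝ → ℂ)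
      (coeff_R₁ (delta M a (ρ x)) (√(ρ x ^ 2 + a ^ 2)) (ρ x) M hA.ne')
    have e₀ := congrArg ((↑) : ℝ → ℂ)
      (coeff_R₀ M a ω m Λ (√(ρ x ^ 2 + a ^ 2)) hA.ne' hΔ.ne')
    push_cast at e₂ e₁ e₀ hode ⊢
    linear_combination R'' (ρ x) * e₂ + R' (ρ x) * e₁ + R (ρ x) * e₀ +
      (delta M a (ρ x) : ℂ) * (√(ρ x ^ 2 + a ^ 2) : ℂ) / ((ρ x : ℂ) ^ 2 + (a : ℂ) ^ 2) ^ 2 * hode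

/-! ### The `u`-Wronskian is `𝔚` -/

/-- **TdC Def. 5.1 = §1**: for `|a| < M`, a tortoise radius function `ρ` and two functions
`R_H`, `R_I` differentiable at `r = ρ x`, the `r*`-Wronskian `u_H u_I′ − u_I u_H′` of
`u = (r² + a²)^{1/2} R` — with `u′ = (Δ/(r² + a²)) d/dr[(r² + a²)^{1/2} R]`, the first derivative
of `schrodingerForm` — equals `𝔚 = Δ^{1+0} (R_H R_I′ − R_I R_H′)` (`Kerr.radialWronskian M a 0`):
the `S′`-terms cancel and `(Δ/(r² + a²)) · S² = Δ`. [cite: Costa2019, Definition 5.1] -/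
theorem wronskian_schrodingerForm {M a : ℝ} (ha : |a| < M) {RH RI : ℝ → ℂ} {ρ : ℝ → ℝ}
    (hρ : IsTortoiseRadius M a ρ) {x : ℝ}
    (hH : DifferentiableAt ℝ RH (ρ x)) (hI : DifferentiableAt ℝ RI (ρ x)) :
    ((Real.sqrt (ρ x ^ 2 + a ^ 2) : ℝ) : ℂ) * RH (ρ x) *
        (((delta M a (ρ x) / (ρ x ^ 2 + a ^ 2) : ℝ) : ℂ) *
          deriv (fun r : ℝ ↦ ((Real.sqrt (r ^ 2 + a ^ 2) : ℝ) : ℂ) * RI r) (ρ x)) -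
      ((Real.sqrt (ρ x ^ 2 + a ^ 2) : ℝ) : ℂ) * RI (ρ x) *
        (((delta M a (ρ x) / (ρ x ^ 2 + a ^ 2) : ℝ) : ℂ) *
          deriv (fun r : ℝ ↦ ((Real.sqrt (r ^ 2 + a ^ 2) : ℝ) : ℂ) * RH r) (ρ x)) =
      radialWronskian M a 0 RH RI (ρ x) := by
  have hA : 0 < ρ x ^ 2 + a ^ 2 := hρ.sq_add_sq_pos ha x
  have hS := hasDerivAt_S hA
  rw [radialWronskian_apply, (hS.ofReal_comp.fun_mul hI.hasDerivAt).deriv,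
    (hS.ofReal_comp.fun_mul hH.hasDerivAt).deriv, add_zero, Real.rpow_one]
  have hS2 : √(ρ x ^ 2 + a ^ 2) ^ 2 = ρ x ^ 2 + a ^ 2 := Real.sq_sqrt hA.le
  have key : ((delta M a (ρ x) / (ρ x ^ 2 + a ^ 2) : ℝ) : ℂ) *
      ((√(ρ x ^ 2 + a ^ 2) : ℝ) : ℂ) ^ 2 = (delta M a (ρ x) : ℂ) := by
    rw [← Complex.ofReal_pow, ← Complex.ofReal_mul, hS2, div_mul_cancel₀ _ hA.ne']
  linear_combination (RH (ρ x) * deriv RI (ρ x) - RI (ρ x) * deriv RH (ρ x)) * key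

end Literature.Geometry.Lorentzian.Kerr

end
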